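import Mathlib
import Summits.NavierStokesRegularity.NavierStokesRegularity.Theorems.TypeIQuarterGateScarEnvelopeTypeISatelliteTowerHullDichotomy

/-!
# Satellite tower for crux `ScarEnvelopeTypeI` (stmt-NavierStokesRegularity-23843) — Part Z4: the DSS NECKLACE (past-DSS transports (ir)regularity of final-time points along `y ↦ μ^k y`)

Part Z4 of nsreg-p3 g28's ROUND-44 artefact (`partZ3.lean`): `regPt_zpow_smul_iff_of_pastDss` and its tools — past-DSS transports (ir)regularity of
final-time points along `y ↦ μ^k y`, `k ∈ ℤ`: one satellite ⇒ `λ₀^ℤ • y` satellites accumulating at the root (not a leaf).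

PROVENANCE: declaration texts VERBATIM from the HOME artefact of the instrument seat nsreg-p3 g27 (cell `pub/ns-regularity-ideate`):
`round-44/Junction44.lean` (sha16 `ec5c26d3f01f4277`, parts `partZ1…partZ7.lean`; a module written against the TREE, importing route
RecurrentProfiles' crux-1589 dynamics modules BY NAME; memo `round-44/ROUND-44.md` c316de8a95807228), scored PASS ★★ by referee ref3 g27
(`SCORE-p3-ROUND-44-0828.md` f10387a6f12e4133); the author cannot write under `Theorems/`
(`perm.theorems-prover-only`); landed by the prover ns-es-p1 g5 as landing hand of record (director-ns DIRECTOR-NS #237 (3)), split into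
≤ 400-line modules, `E3` spelled out, the artefact's `#guard_msgs … #print axioms` certificates not landed.
`--supports stmt-NavierStokesRegularity-23843 --as helper`.

HONEST FRAMING: instrument theorems about HYPOTHETICAL Type-I zoom limits (Albritton–Barker objects of the census of crux
`TypeIQuarterGate.ScarEnvelopeTypeI`, item 23843); the analytic input is the tree's closure engine (compactness
`local_typeI_compactness_twin_inBall`, sharpened to constant 1 in Part S1; Q1 whole-space), P1 rate inheritance, L8 persistence and the
tree's PROVED small-constant Liouville theorem; Parts R/S are order theory on the re-classing and closure lemmas.  NOTHING OPEN IS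
PROVED: 23843, (L′) `TypeILiouvilleAB` / (L′₀), the GLOBAL (S∞) = `CritAttained`, (M𝐈₁), (E1⁺), (E2ᵣ), route ExtremalTypeIConstant's
cruxes, N0 and Navier–Stokes regularity are OPEN; `critRate`, `levelCrit I`, `liouvilleRate` are `sInf`s that are `0` by junk value
when the defining set is empty (every statement using them carries the nonemptiness hypothesis explicitly).
-/

-- the summit-side namespace repeats a component by design (single-conjunct summit, D-0017)
set_option linter.dupNamespace false

open MeasureTheory Set Metric Filter Topology
open scoped ENNReal NNReal InnerProductSpace
open Literature.Analysis.FluidPDE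

namespace Summit.NavierStokesRegularity.NavierStokesRegularity.Cruxes.ScarEnvelopeTypeI.ZoomDictionary

section HullJunction

variable {U U₁ U₂ W : ℝ → (EuclideanSpace ℝ (Fin 3)) → (EuclideanSpace ℝ (Fin 3))}
  {P : ℝ → (EuclideanSpace ℝ (Fin 3)) → ℝ}
  {H : ℝ → (EuclideanSpace ℝ (Fin 3)) → (EuclideanSpace ℝ (Fin 3)) →L[ℝ] (EuclideanSpace ℝ (Fin 3))}
  {M : ℝ}

/-! ### Z4. THE NECKLACE: past-DSS transports final-time (ir)regularity along `y ↦ μ^k y` -/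

/-- `RegPt` only sees the open past: fields agreeing at every `t < 0` have the same regular points. -/
theorem RegPt.congr_past {y : (EuclideanSpace ℝ (Fin 3))} (hr : RegPt U₁ y)
    (h : ∀ t < 0, ∀ x, U₁ t x = U₂ t x) : RegPt U₂ y := by
  obtain ⟨r, hr0, B, hB⟩ := hr
  refine ⟨r, hr0, B, ?_⟩
  filter_upwards [hB, ae_restrict_mem (isOpen_parabolicCylinder _ _).measurableSet] with z hz hzQ
  rw [mem_parabolicCylinder] at hzQ
  have ht : z.1 < 0 := by simpa using hzQ.1.2
  rw [← h z.1 ht z.2]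
  exact hz

/-- Past-DSS with factor `c` is past-DSS with factor `c⁻¹`. -/
theorem pastDss_inv {c : ℝ} (hc : 0 < c) (h : ∀ t < 0, ∀ x, nsRescale c U t x = U t x) :
    ∀ t < 0, ∀ x, nsRescale c⁻¹ U t x = U t x := by
  intro t ht x
  have ht' : c⁻¹ ^ 2 * t < 0 := mul_neg_of_pos_of_neg (by positivity) ht
  have h1 := h (c⁻¹ ^ 2 * t) ht' (c⁻¹ • x)
  simp only [nsRescale_apply, smul_smul, mul_inv_cancel₀ hc.ne', one_smul] at h1 ⊢
  rw [show c ^ 2 * (c⁻¹ ^ 2 * t) = t by field_simp] at h1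
  rw [← h1, smul_smul, inv_mul_cancel₀ hc.ne', one_smul]

/-- **One bead.**  For a past-DSS field with factor `c > 0`: `c • y` is regular iff `y` is. -/
theorem regPt_smul_iff_of_pastDss {c : ℝ} (hc : 0 < c) (h : ∀ t < 0, ∀ x, nsRescale c U t x = U t x)
    (y : (EuclideanSpace ℝ (Fin 3))) : RegPt U (c • y) ↔ RegPt U y := by
  have key : ∀ {c : ℝ}, 0 < c → (∀ t < 0, ∀ x, nsRescale c U t x = U t x) →
      ∀ y : (EuclideanSpace ℝ (Fin 3)), RegPt U (c • y) → RegPt U y := by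
    intro c hc h y hy
    have h1 : RegPt (zoom U 0 0 c) y :=
      ScarTopology.regPt_zoom_of_regPt hc (y₀ := 0) (by rwa [zero_add])
    rw [zoom_zero_eq_nsRescale] at h1
    exact h1.congr_past h
  refine ⟨key hc h y, fun hy => ?_⟩
  have h2 := key (inv_pos.2 hc) (pastDss_inv hc h) (c • y)
  rw [smul_smul, inv_mul_cancel₀ hc.ne', one_smul] at h2
  exact h2 hy

/-- ★ **Z4. THE NECKLACE.**  For a past-DSS field with factor `c > 0` and every `k ∈ ℤ`: `c^k • y` is a
regular final-time point iff `y` is.  Hence the satellites of an exactly past-DSS rooted object form a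
NECKLACE `{c^k y}` — accumulating at the root (`k → -∞` when `c > 1`) and escaping to infinity. -/
theorem regPt_zpow_smul_iff_of_pastDss {c : ℝ} (hc : 0 < c)
    (h : ∀ t < 0, ∀ x, nsRescale c U t x = U t x) (y : (EuclideanSpace ℝ (Fin 3))) (k : ℤ) :
    RegPt U ((c ^ k) • y) ↔ RegPt U y := by
  induction k with
  | zero => simp
  | succ k ih =>
      rw [zpow_add_one₀ hc.ne', mul_comm, mul_smul, regPt_smul_iff_of_pastDss hc h, ih]
  | pred k ih =>
      rw [zpow_sub_one₀ hc.ne', mul_comm, mul_smul,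
        regPt_smul_iff_of_pastDss (inv_pos.2 hc) (pastDss_inv hc h), ih]

/-- **The necklace accumulates at the root.**  A past-DSS field (`c > 1`) with ONE satellite `y ≠ 0` has
satellites of arbitrarily small norm — in particular it is NOT a leaf (`¬ LeafNode`), whatever `‖y‖`. -/
theorem exists_small_satellite_of_pastDss {c : ℝ} (hc : 1 < c)
    (h : ∀ t < 0, ∀ x, nsRescale c U t x = U t x) {y : (EuclideanSpace ℝ (Fin 3))} (hy0 : y ≠ 0)
    (hy : ¬ RegPt U y) {ε : ℝ} (hε : 0 < ε) :
    ∃ y' : (EuclideanSpace ℝ (Fin 3)), y' ≠ 0 ∧ ‖y'‖ < ε ∧ ¬ RegPt U y' := by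
  have hc0 : 0 < c := lt_trans zero_lt_one hc
  -- `c⁻¹ ^ m → 0`
  have hlim : Tendsto (fun m : ℕ => (c⁻¹) ^ m * ‖y‖) atTop (𝓝 (0 * ‖y‖)) :=
    (tendsto_pow_atTop_nhds_zero_of_lt_one (inv_nonneg.2 hc0.le) (inv_lt_one_of_one_lt₀ hc)).mul_const _
  rw [zero_mul] at hlim
  obtain ⟨m, hm⟩ := (hlim.eventually (gt_mem_nhds hε)).exists
  refine ⟨(c ^ (-(m : ℤ))) • y, smul_ne_zero (zpow_ne_zero _ hc0.ne') hy0, ?_, ?_⟩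
  · rw [norm_smul, zpow_neg, zpow_natCast, norm_inv, norm_pow, Real.norm_of_nonneg hc0.le, ← inv_pow]
    exact hm
  · rwa [regPt_zpow_smul_iff_of_pastDss hc0 h]

/-- A past-DSS node (`c > 1`) with a satellite anywhere is not a leaf. -/
theorem not_leafNode_of_pastDss_satellite {n : TNode} {c : ℝ} (hc : 1 < c)
    (h : ∀ t < 0, ∀ x, nsRescale c n.U t x = n.U t x) {y : (EuclideanSpace ℝ (Fin 3))} (hy0 : y ≠ 0)
    (hy : ¬ RegPt n.U y) : ¬ LeafNode n := by
  intro hleaf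
  obtain ⟨y', hy'0, hy'1, hy'⟩ := exists_small_satellite_of_pastDss hc h hy0 hy one_pos
  exact hy' (hleaf y' hy'0 hy'1)

/-! ### Z5. TAME ⟺ ENVELOPED ⟺ SATELLITE-FREE-AND-TAME for past-DSS rooted objects: the tame DSS cell is the
printed wall object (a globally enveloped `λ`-DSS one-scar ancient solution) -/

/-- **Past-DSS spreads a local envelope over the whole past.**  If `‖U(t,x)‖ ≤ A/(‖x‖ + √(-t))` on the window
`(-δ², 0) × B_δ(0)` and `U` is past-DSS with a factor `c > 1`, then `HasTypeIDecay A U` (every `t < 0`, every `x`). -/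
theorem hasTypeIDecay_of_locEnv_pastDss {n : TNode} {A δ c : ℝ} (hδ : 0 < δ) (henv : LocEnv A δ n)
    (hc : 1 < c) (h : ∀ t < 0, ∀ x, nsRescale c n.U t x = n.U t x) : HasTypeIDecay A n.U := by
  have hc0 : 0 < c := lt_trans zero_lt_one hc
  intro t ht x
  -- choose `m` with `c⁻¹ ^ m · (‖x‖ + √(-t)) < δ`
  set ρ : ℝ := ‖x‖ + Real.sqrt (-t) with hρ
  have hρ0 : 0 < ρ := add_pos_of_nonneg_of_pos (norm_nonneg _) (Real.sqrt_pos.2 (neg_pos.2 ht))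
  have hlim : Tendsto (fun m : ℕ => (c⁻¹) ^ m * ρ) atTop (𝓝 (0 * ρ)) :=
    (tendsto_pow_atTop_nhds_zero_of_lt_one (inv_nonneg.2 hc0.le) (inv_lt_one_of_one_lt₀ hc)).mul_const _
  rw [zero_mul] at hlim
  obtain ⟨m, hm⟩ := (hlim.eventually (gt_mem_nhds hδ)).exists
  set a : ℝ := (c⁻¹) ^ m with ha
  have ha0 : 0 < a := pow_pos (inv_pos.2 hc0) m
  -- past-DSS with factor `a = c^{-m}`
  have hinv := pastDss_inv hc0 h
  have hpow : ∀ (j : ℕ), ∀ t < 0, ∀ x, nsRescale ((c⁻¹) ^ j) n.U t x = n.U t x := by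
    intro j
    induction j with
    | zero => intro t ht x; simp [nsRescale_apply]
    | succ j ih =>
        intro t ht x
        rw [pow_succ, nsRescale_mul]
        have ht' : (c⁻¹) ^ 2 * t < 0 := mul_neg_of_pos_of_neg (by positivity) ht
        rw [nsRescale_apply, ih _ ht', ← nsRescale_apply, hinv t ht x]
  have key := hpow m t ht x
  rw [nsRescale_apply] at key
  -- the rescaled point lies in the window
  have ht' : a ^ 2 * t ∈ Ioo (-(δ ^ 2)) 0 := by
    refine ⟨?_, mul_neg_of_pos_of_neg (by positivity) ht⟩
    have h1 : a * Real.sqrt (-t) < δ := by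
      have : a * Real.sqrt (-t) ≤ a * ρ := by
        rw [hρ]; exact mul_le_mul_of_nonneg_left (by linarith [norm_nonneg x]) ha0.le
      exact lt_of_le_of_lt this hm
    have h2 : (a * Real.sqrt (-t)) ^ 2 < δ ^ 2 := by
      exact pow_lt_pow_left₀ h1 (by positivity) two_ne_zero
    rw [mul_pow, Real.sq_sqrt (neg_pos.2 ht).le] at h2
    linarith
  have hx' : a • x ∈ ball (0 : (EuclideanSpace ℝ (Fin 3))) δ := by
    rw [mem_ball_zero_iff, norm_smul, Real.norm_of_nonneg ha0.le]
    have : a * ‖x‖ ≤ a * ρ := by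
      rw [hρ]; exact mul_le_mul_of_nonneg_left (by linarith [Real.sqrt_nonneg (-t)]) ha0.le
    exact lt_of_le_of_lt this hm
  have hb := henv _ ht' _ hx'
  -- `‖U(t,x)‖ = a ‖U(a²t, a x)‖ ≤ a · A/(a ρ) = A/ρ`
  rw [← key, norm_smul, Real.norm_of_nonneg ha0.le]
  have hden : ‖a • x‖ + Real.sqrt (-(a ^ 2 * t)) = a * ρ := by
    rw [norm_smul, Real.norm_of_nonneg ha0.le, show -(a ^ 2 * t) = a ^ 2 * (-t) by ring,
      Real.sqrt_mul' _ (neg_pos.2 ht).le, Real.sqrt_sq ha0.le, hρ]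
    ring
  rw [hden] at hb
  have hA : 0 ≤ A := henv.nonneg hδ
  calc a * ‖n.U (a ^ 2 * t) (a • x)‖ ≤ a * (A / (a * ρ)) := mul_le_mul_of_nonneg_left hb ha0.le
    _ = A / ρ := by field_simp

/-- ★ **Z5. THE TAME DSS CELL IS THE PRINTED WALL OBJECT.**  For a rooted A–B object which is exactly
past-DSS with a factor `c > 1`, the following are equivalent: (i) it is TAME at the root (`TameRoot`, the
slice budget); (ii) it is GLOBALLY ENVELOPED: `‖U(t,x)‖ ≤ A/(‖x‖ + √(-t))` for every `t < 0` and every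
`x` — the standing hypothesis of the printed DSS exclusions (Bradshaw–Tsai, Chae–Wolf 2017 Thm 1.3 /
Rem 1.6) —; and then (iii) it has NO SATELLITES at all (every `y ≠ 0` is regular): a ONE-SCAR `λ`-DSS leaf. -/
theorem tameRoot_iff_hasTypeIDecay_of_pastDss {n : TNode} (hT : ABTower M n.U n.P n.H) {c : ℝ} (hc : 1 < c)
    (h : ∀ t < 0, ∀ x, nsRescale c n.U t x = n.U t x) :
    TameRoot n ↔ ∃ A : ℝ, HasTypeIDecay A n.U := by
  constructor
  · intro ht
    obtain ⟨A, δ, hδ, henv⟩ := (towerObj_of_abTower hT).envelope_of_budgetAt ht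
    refine ⟨A, hasTypeIDecay_of_locEnv_pastDss (A := A) (δ := δ) hδ (fun t ht x hx => ?_) hc h⟩
    simpa using henv t ht x hx
  · rintro ⟨A, hA⟩
    refine hT.budgetAt_of_envelope (A := A) one_pos fun t ht x _ => ?_
    simpa using hA t ht.2 x

/-- (ii) ⇒ (iii): a globally enveloped field has no satellites. -/
theorem satellites_empty_of_hasTypeIDecay {A : ℝ} (hA : HasTypeIDecay A U) :
    ∀ y : (EuclideanSpace ℝ (Fin 3)), y ≠ 0 → RegPt U y :=
  fun _ hy => regPt_of_hasTypeIDecay hA hy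

/-- **The wild DSS cell carries a necklace or is a wild leaf.**  A rooted past-DSS A–B object (`c > 1`) which
is NOT tame is not globally enveloped; if it has a satellite `y ≠ 0` then it has satellites `c^k y` for all
`k ∈ ℤ`, accumulating at the root. -/
theorem necklace_of_pastDss_satellite {c : ℝ} (hc : 1 < c) (h : ∀ t < 0, ∀ x, nsRescale c U t x = U t x)
    {y : (EuclideanSpace ℝ (Fin 3))} (hy : ¬ RegPt U y) (k : ℤ) : ¬ RegPt U ((c ^ k) • y) := by
  rwa [regPt_zpow_smul_iff_of_pastDss (lt_trans zero_lt_one hc) h]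

end HullJunction

end Summit.NavierStokesRegularity.NavierStokesRegularity.Cruxes.ScarEnvelopeTypeI.ZoomDictionary
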